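import Literature.NumberTheory.Sieve.IdealSieveSums
import HarnessLib

/-!
# One-dimensional sieve sums over `𝓞_K`, sharp form: `∑_{(𝔲,𝔴)=1} μ²(𝔲)/φ(𝔲) = ρ_K (φ(𝔴)/N𝔴)(1 + O(D₀^{-1/4})) log x + O_𝔴(1)`

Topic `Literature/NumberTheory/Sieve`, sequel of `IdealSieveSums.lean` (namespace
`Literature.NumberTheory.Sieve.IdealSieve`). Everything in this file is PROVED (theorems only).

`IdealSieveSums.abs_sum_inv_totientIdeal_sub_le` evaluates the sums
`∑_{N𝔲 ≤ x, (𝔲,𝔴)=1} μ²(𝔲)/φ(𝔲)` of Castillo–Hall–Lemke Oliver–Pollack–Thompson (arXiv:1403.5808,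
§2.2; Maynard's (5.13), (6.5)) with an error `C · 2^{ω(𝔴)} (1 + D₀^{-1/4} log x)` whose RELATIVE part
`2^{ω(𝔴)} D₀^{-1/4}` does not tend to `0` for the sieve modulus `𝔴 = ∏_{N𝔭 ≤ D₀} 𝔭`. The evaluation
of the main terms of Lemmas 2.2/2.3 (the counting functions fed into the `k`-dimensional
equidistribution argument, as over `ℤ` in the tree's `MaynardSieveLemma62.lean`) needs the sharp form
in which the relative error is `O(D₀^{-1/4})` uniformly in `𝔴` and only the additive error depends on
`𝔴` — exactly the shape of the tree's `SquarefreeSums.abs_sum_wfun_div_sub_le` /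
`abs_bsum_sub_one_le` over `ℤ`. This file proves it by the `ℤ`-style route: write
`W = B' ⋆ 𝟙_𝔴` with `B'` the restriction of `B` to the ideals COPRIME to `𝔴` and `𝟙_𝔴` the indicator
of the ideals coprime to `𝔴`, and use the coprime harmonic sum
`CoprimeIdealHarmonicSum.abs_coprimeHarmonic_sub_le` (error `∑_{𝔢∣𝔴}(C + ρ log N𝔢)/N𝔢`):

* `sum_abs_sieveB_mul_rpow_coprime_le` — the Euler majorant WITHOUT the factor `2^{ω(𝔴)}`:
  `∑_{N𝔡 ≤ x, (𝔡,𝔴)=1} |B(𝔡)| N𝔡^{-3/4} ≤ exp((1+2C₀) ∑_P NP^{-3/2})`;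
* `sieveW_div_eq_sum_coprime` (`W(𝔲)/N𝔲 = [(𝔲,𝔴)=1] ∑_{𝔡∣𝔲,(𝔡,𝔴)=1} B(𝔡)/N𝔲`),
  `abs_sum_sieveW_div_sub_coprime_le` —
  `|∑_{N𝔲≤x} W(𝔲)/N𝔲 − ρ_K d(𝔴) β'(x) log x| ≤ (E(𝔴) + 4ρ_K) M`, `β'(x) = ∑_{N𝔡≤x,(𝔡,𝔴)=1} B(𝔡)/N𝔡`,
  `d(𝔴) = ∑_{𝔢∣𝔴} μ(𝔢)/N𝔢 = φ(𝔴)/N𝔴`, `E(𝔴) = ∑_{𝔢∣𝔴} (C + ρ log N𝔢)/N𝔢`;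
* `abs_bsum_coprime_sub_one_le` — `|β'(x) − 1| ≤ D₀^{-1/4} M` when every prime of norm `≤ D₀`
  divides `𝔴` (the other `𝔡` with `B'(𝔡) ≠ 0` have norm `> D₀`);
* **`abs_sum_sieveW_div_sub_sharp`** — the assembled estimate
  `|∑ W/N𝔲 − ρ_K d(𝔴) log x| ≤ e^{(1+2C₀)Z} (E(𝔴) + 4ρ_K + ρ_K D₀^{-1/4} log x)` for `x ≥ 1`;
  **`abs_sum_inv_totientIdeal_sub_sharp`** (`c_P = 1/(NP−1)`: `∑ μ²/φ`) and
  **`abs_sum_inv_gIdeal_sub_sharp`** (`c_P = 2/(NP−2)`: `∑ μ²/g`, `g(𝔭) = N𝔭 − 2`).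

## References

* H. Halberstam, H.-E. Richert, *Sieve Methods* (1974), Ch. 3, (3.1.11) and Lemma 3.1 (the prototype
  over `ℤ`). [folklore]
* A. Castillo et al., arXiv:1403.5808, §2.2 (the consumer: "`∑_{N𝔲<R,(𝔲,𝔴)=1} μ²(𝔲)/φ(𝔲) ≪ φ(𝔴) log R/|𝔴|`"
  and the main terms of Lemmas 2.2–2.3). [CastilloEtAl2015]
-/

noncomputable section

open Finset
open scoped NumberField Classical

namespace Literature.NumberTheory.Sieve.IdealSieve

open UniqueFactorizationMonoid Literature.NumberTheory.LFunctions
  Literature.NumberTheory.LFunctions.NumberField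

variable {K : Type*} [Field K] [NumberField K]
variable (𝔴 : Ideal (𝓞 K)) (c : Ideal (𝓞 K) → ℝ)

/-! ### The Euler majorant for `B` on the ideals coprime to `𝔴` -/

/-- A nonzero ideal coprime to `𝔴` has no prime factor dividing `𝔴`; each prime factor of a member
of `idealsLE K x` has norm `≤ x`. [folklore] -/
theorem prime_factor_mem_of_coprime {x : ℝ} {𝔡 : Ideal (𝓞 K)} (h𝔡 : 𝔡 ∈ idealsLE K x)
    (hcop : 𝔡 ⊔ 𝔴 = ⊤) {Q : Ideal (𝓞 K)} (hQ : Q ∈ normalizedFactors 𝔡) :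
    Q ∈ (finite_primeIdealsLE K x).toFinset ∧ ¬ Q ∣ 𝔴 := by
  have h𝔡0 := (mem_idealsLE.1 h𝔡).1
  have hQp := prime_of_normalized_factor Q hQ
  refine ⟨?_, (sup_eq_top_iff_forall_not_dvd h𝔡0).1 hcop Q hQ⟩
  rw [Set.Finite.mem_toFinset]
  refine ⟨Ideal.isPrime_of_prime hQp, hQp.ne_zero, ?_⟩
  have hdvd : Ideal.absNorm Q ∣ Ideal.absNorm 𝔡 := map_dvd _ (dvd_of_mem_normalizedFactors hQ)
  have hN𝔡 : Ideal.absNorm 𝔡 ≠ 0 := by rwa [Ne, Ideal.absNorm_eq_zero_iff]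
  calc (Ideal.absNorm Q : ℝ) ≤ Ideal.absNorm 𝔡 := by
        exact_mod_cast Nat.le_of_dvd (Nat.pos_of_ne_zero hN𝔡) hdvd
    _ ≤ x := (mem_idealsLE.1 h𝔡).2

/-- **The Euler-product majorant for `B` on the ideals coprime to `𝔴`** (no factor `2^{ω(𝔴)}`):
with `T` the primes of norm `≤ x` and `|c_P| ≤ C₀/NP` (`C₀ ≥ 0`),
`∑_{0 < N𝔡 ≤ x, (𝔡,𝔴)=1} |B(𝔡)| N𝔡^{-3/4} ≤ exp((1 + 2C₀) ∑_{P ∈ T} NP^{-3/2})`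
(the sum is at most the divisor sum of the multiplicative `|B| N^{-3/4}` over `∏_{P ∈ T, P ∤ 𝔴} P²`).
[folklore] -/
theorem sum_abs_sieveB_mul_rpow_coprime_le {C₀ : ℝ} (hC₀ : 0 ≤ C₀)
    (hc : ∀ P : Ideal (𝓞 K), Prime P → |c P| ≤ C₀ / Ideal.absNorm P) (x : ℝ) :
    ∑ 𝔡 ∈ (idealsLE K x).filter (fun 𝔡 => 𝔡 ⊔ 𝔴 = ⊤),
        |sieveB 𝔴 c 𝔡| * ((Ideal.absNorm 𝔡 : ℕ) : ℝ) ^ (-(3 : ℝ) / 4) ≤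
      Real.exp ((1 + 2 * C₀) * ∑ P ∈ (finite_primeIdealsLE K x).toFinset,
          ((Ideal.absNorm P : ℕ) : ℝ) ^ (-(3 : ℝ) / 2)) := by
  set g : Ideal (𝓞 K) → ℕ → ℝ := fun P j =>
    |sieveBloc 𝔴 c P j| * ((Ideal.absNorm P : ℕ) : ℝ) ^ (-(3 : ℝ) / 4 * j) with hg
  have hg0 : ∀ P j, 0 ≤ g P j := fun P j => by positivity
  set T₀ := (finite_primeIdealsLE K x).toFinset with hT₀
  set T := T₀.filter (fun P => ¬ P ∣ 𝔴) with hT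
  have hT₀prime : ∀ P ∈ T₀, Prime P := by
    intro P hP
    rw [hT₀, Set.Finite.mem_toFinset] at hP
    exact Ideal.prime_of_isPrime hP.2.1 hP.1
  have hTprime : ∀ P ∈ T, Prime P := fun P hP => hT₀prime P (Finset.mem_filter.1 hP).1
  have hTnot : ∀ P ∈ T, ¬ P ∣ 𝔴 := fun P hP => (Finset.mem_filter.1 hP).2
  set 𝔐 : Ideal (𝓞 K) := ∏ P ∈ T, P ^ 2 with h𝔐
  have h𝔐0 : 𝔐 ≠ ⊥ := by
    rw [h𝔐, Ne, ← Ideal.zero_eq_bot, Finset.prod_eq_zero_iff]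
    rintro ⟨P, hP, h0⟩
    exact (hTprime P hP).ne_zero (pow_eq_zero_iff two_ne_zero |>.1 h0)
  have hnf𝔐 := normalizedFactors_prod_sq hTprime
  have hcount𝔐 : ∀ Q, Multiset.count Q (normalizedFactors 𝔐) = if Q ∈ T then 2 else 0 := fun Q => by
    rw [hnf𝔐, count_bind_replicate_two]
  have htf𝔐 : (normalizedFactors 𝔐).toFinset = T := by
    ext Q
    rw [Multiset.mem_toFinset, ← Multiset.one_le_count_iff_mem, hcount𝔐]
    split_ifs with h <;> simp [h]
  -- Step 1: pass to the divisors of `𝔐`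
  have hstep1 : ∑ 𝔡 ∈ (idealsLE K x).filter (fun 𝔡 => 𝔡 ⊔ 𝔴 = ⊤),
      |sieveB 𝔴 c 𝔡| * ((Ideal.absNorm 𝔡 : ℕ) : ℝ) ^ (-(3 : ℝ) / 4) ≤
      ∑ 𝔡 ∈ idealDivisors K 𝔐, ppMul g 𝔡 := by
    have heq : ∑ 𝔡 ∈ (idealsLE K x).filter (fun 𝔡 => 𝔡 ⊔ 𝔴 = ⊤),
        |sieveB 𝔴 c 𝔡| * ((Ideal.absNorm 𝔡 : ℕ) : ℝ) ^ (-(3 : ℝ) / 4) =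
        ∑ 𝔡 ∈ (idealsLE K x).filter (fun 𝔡 => 𝔡 ⊔ 𝔴 = ⊤), ppMul g 𝔡 :=
      Finset.sum_congr rfl fun 𝔡 h𝔡 =>
        abs_sieveB_mul_rpow_eq 𝔴 c (mem_idealsLE.1 (Finset.mem_filter.1 h𝔡).1).1
    rw [heq]
    have hzero : ∀ 𝔡 ∈ (idealsLE K x).filter (fun 𝔡 => 𝔡 ⊔ 𝔴 = ⊤), 𝔡 ∉ idealDivisors K 𝔐 →
        ppMul g 𝔡 = 0 := by
      intro 𝔡 h𝔡 hnot
      obtain ⟨h𝔡A, hcop⟩ := Finset.mem_filter.1 h𝔡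
      have h𝔡0 := (mem_idealsLE.1 h𝔡A).1
      have h𝔡0' : (𝔡 : Ideal (𝓞 K)) ≠ 0 := by rwa [Ne, Ideal.zero_eq_bot]
      by_contra hne
      refine hnot ((mem_idealDivisors h𝔐0).2 ?_)
      rw [dvd_iff_normalizedFactors_le_normalizedFactors h𝔡0' (by rwa [Ne, Ideal.zero_eq_bot]),
        Multiset.le_iff_count]
      intro Q
      rw [hcount𝔐]
      by_cases hQ : Q ∈ normalizedFactors 𝔡
      · obtain ⟨hQT₀, hQw⟩ := prime_factor_mem_of_coprime 𝔴 h𝔡A hcop hQ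
        have hQT : Q ∈ T := Finset.mem_filter.2 ⟨hQT₀, hQw⟩
        rw [if_pos hQT]
        by_contra hlt
        refine hne (Finset.prod_eq_zero (Multiset.mem_toFinset.2 hQ) ?_)
        have h3 : 3 ≤ Multiset.count Q (normalizedFactors 𝔡) := by omega
        simp only [hg, sieveBloc_eq_zero_of_three_le 𝔴 c Q h3, abs_zero, zero_mul]
      · rw [Multiset.count_eq_zero_of_notMem hQ]; exact Nat.zero_le _
    calc ∑ 𝔡 ∈ (idealsLE K x).filter (fun 𝔡 => 𝔡 ⊔ 𝔴 = ⊤), ppMul g 𝔡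
        = ∑ 𝔡 ∈ ((idealsLE K x).filter (fun 𝔡 => 𝔡 ⊔ 𝔴 = ⊤)).filter (· ∈ idealDivisors K 𝔐),
            ppMul g 𝔡 +
          ∑ 𝔡 ∈ ((idealsLE K x).filter (fun 𝔡 => 𝔡 ⊔ 𝔴 = ⊤)).filter (fun 𝔡 => ¬ 𝔡 ∈ idealDivisors K 𝔐),
            ppMul g 𝔡 := (Finset.sum_filter_add_sum_filter_not _ _ _).symm
      _ = ∑ 𝔡 ∈ ((idealsLE K x).filter (fun 𝔡 => 𝔡 ⊔ 𝔴 = ⊤)).filter (· ∈ idealDivisors K 𝔐),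
            ppMul g 𝔡 := by
          rw [Finset.sum_eq_zero (s := ((idealsLE K x).filter (fun 𝔡 => 𝔡 ⊔ 𝔴 = ⊤)).filter
            (fun 𝔡 => ¬ 𝔡 ∈ idealDivisors K 𝔐)) fun 𝔡 h𝔡 =>
              hzero 𝔡 (Finset.mem_filter.1 h𝔡).1 (Finset.mem_filter.1 h𝔡).2, add_zero]
      _ ≤ ∑ 𝔡 ∈ idealDivisors K 𝔐, ppMul g 𝔡 :=
          Finset.sum_le_sum_of_subset_of_nonneg (fun 𝔡 h => (Finset.mem_filter.1 h).2)
            fun 𝔡 _ _ => ppMul_nonneg hg0 𝔡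
  -- Step 2: factor the divisor sum and bound the local factors (all primes of `T` are prime to `𝔴`)
  refine hstep1.trans ?_
  rw [sum_divisors_ppMul g h𝔐0 (fun 𝔡 => mem_idealDivisors h𝔐0), htf𝔐]
  have hlocal : ∀ P ∈ T, ∑ j ∈ Finset.range (Multiset.count P (normalizedFactors 𝔐) + 1),
      (if j = 0 then (1 : ℝ) else g P j) ≤
      Real.exp ((1 + 2 * C₀) * ((Ideal.absNorm P : ℕ) : ℝ) ^ (-(3 : ℝ) / 2)) := by
    intro P hP
    have hPp := hTprime P hP
    have hPw := hTnot P hP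
    rw [hcount𝔐, if_pos hP]
    have hsum : ∑ j ∈ Finset.range (2 + 1), (if j = 0 then (1 : ℝ) else g P j) = 1 + g P 1 + g P 2 := by
      simp [Finset.sum_range_succ]
    rw [hsum]
    have hN2 : (2 : ℝ) ≤ ((Ideal.absNorm P : ℕ) : ℝ) := by exact_mod_cast two_le_absNorm_of_prime hPp
    have hN0 : (0 : ℝ) < ((Ideal.absNorm P : ℕ) : ℝ) := by linarith
    have hg1 : g P 1 = |sieveBloc 𝔴 c P 1| * ((Ideal.absNorm P : ℕ) : ℝ) ^ (-(3 : ℝ) / 4) := by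
      simp only [hg, Nat.cast_one, mul_one]
    have hg2 : g P 2 = |sieveBloc 𝔴 c P 2| * ((Ideal.absNorm P : ℕ) : ℝ) ^ (-(3 : ℝ) / 2) := by
      simp only [hg, Nat.cast_ofNat]
      norm_num
    obtain ⟨hb1, hb2⟩ := sieveBloc_one_two 𝔴 c P
    have hrpow0 : 0 ≤ ((Ideal.absNorm P : ℕ) : ℝ) ^ (-(3 : ℝ) / 2) := by positivity
    rw [hg1, hg2, hb1, hb2, if_neg hPw, if_neg hPw, abs_neg]
    have hcP := hc P hPp
    have h1c : |1 + c P| ≤ 1 + C₀ := by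
      have hcP' : |c P| ≤ C₀ := hcP.trans (div_le_self hC₀ (by linarith))
      exact (abs_add_le _ _).trans (by rw [abs_one]; linarith)
    have hA : |c P| * ((Ideal.absNorm P : ℕ) : ℝ) ^ (-(3 : ℝ) / 4) ≤
        C₀ * ((Ideal.absNorm P : ℕ) : ℝ) ^ (-(3 : ℝ) / 2) := by
      calc |c P| * ((Ideal.absNorm P : ℕ) : ℝ) ^ (-(3 : ℝ) / 4)
          ≤ C₀ / ((Ideal.absNorm P : ℕ) : ℝ) * ((Ideal.absNorm P : ℕ) : ℝ) ^ (-(3 : ℝ) / 4) :=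
            mul_le_mul_of_nonneg_right hcP (by positivity)
        _ = C₀ * ((Ideal.absNorm P : ℕ) : ℝ) ^ (-(7 : ℝ) / 4) := by
            rw [div_eq_mul_inv, ← Real.rpow_neg_one, mul_assoc, ← Real.rpow_add hN0]
            norm_num
        _ ≤ C₀ * ((Ideal.absNorm P : ℕ) : ℝ) ^ (-(3 : ℝ) / 2) := by
            refine mul_le_mul_of_nonneg_left ?_ hC₀
            exact Real.rpow_le_rpow_of_exponent_le (by linarith) (by norm_num)
    have hB : |1 + c P| * ((Ideal.absNorm P : ℕ) : ℝ) ^ (-(3 : ℝ) / 2) ≤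
        (1 + C₀) * ((Ideal.absNorm P : ℕ) : ℝ) ^ (-(3 : ℝ) / 2) :=
      mul_le_mul_of_nonneg_right h1c hrpow0
    have hE := Real.add_one_le_exp ((1 + 2 * C₀) * ((Ideal.absNorm P : ℕ) : ℝ) ^ (-(3 : ℝ) / 2))
    nlinarith
  have hnonneg : ∀ P ∈ T, 0 ≤ ∑ j ∈ Finset.range (Multiset.count P (normalizedFactors 𝔐) + 1),
      (if j = 0 then (1 : ℝ) else g P j) := fun P _ =>
    Finset.sum_nonneg fun j _ => by split_ifs <;> first | exact zero_le_one | exact hg0 _ _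
  refine (Finset.prod_le_prod hnonneg hlocal).trans ?_
  rw [← Real.exp_sum, ← Finset.mul_sum]
  refine Real.exp_le_exp.2 (mul_le_mul_of_nonneg_left ?_ (by linarith))
  exact Finset.sum_le_sum_of_subset_of_nonneg (Finset.filter_subset _ _) fun _ _ _ => by positivity

/-! ### `W = B' ⋆ 𝟙_𝔴` and the main estimate with the coprime harmonic sum -/

/-- **`W(𝔲)/N𝔲 = [(𝔲,𝔴)=1] ∑_{𝔡 ∣ 𝔲, (𝔡,𝔴)=1} B(𝔡)/N𝔲`** for `𝔲 ∈ idealsLE K x`: the divisors of an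
ideal coprime to `𝔴` are coprime to `𝔴` (so the restriction is vacuous and `∑_{𝔡∣𝔲} B(𝔡) = W(𝔲)`),
and `W` vanishes off the ideals coprime to `𝔴`. [folklore] -/
theorem sieveW_div_eq_sum_coprime {x : ℝ} {𝔲 : Ideal (𝓞 K)} (h𝔲 : 𝔲 ∈ idealsLE K x) :
    sieveW 𝔴 c 𝔲 / ((Ideal.absNorm 𝔲 : ℕ) : ℝ) =
      ∑ 𝔡 ∈ ((idealsLE K x).filter (fun 𝔡 => 𝔡 ⊔ 𝔴 = ⊤)).filter (· ∣ 𝔲),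
        sieveB 𝔴 c 𝔡 * (if 𝔲 ⊔ 𝔴 = ⊤ then 1 else 0) / ((Ideal.absNorm 𝔲 : ℕ) : ℝ) := by
  have h𝔲0 := (mem_idealsLE.1 h𝔲).1
  by_cases hcop : 𝔲 ⊔ 𝔴 = ⊤
  · simp only [if_pos hcop, mul_one]
    rw [← Finset.sum_div, sum_divisors_sieveB 𝔴 c h𝔲0]
    intro 𝔡
    rw [Finset.mem_filter, Finset.mem_filter, mem_idealsLE]
    constructor
    · exact fun h => h.2
    · intro h
      have h𝔡0 : 𝔡 ≠ ⊥ := by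
        rintro rfl; rw [Ideal.dvd_iff_le, le_bot_iff] at h; exact h𝔲0 h
      have hN𝔲 : Ideal.absNorm 𝔲 ≠ 0 := by rw [Ne, Ideal.absNorm_eq_zero_iff]; exact h𝔲0
      refine ⟨⟨⟨h𝔡0, le_trans ?_ (mem_idealsLE.1 h𝔲).2⟩, ?_⟩, h⟩
      · exact_mod_cast Nat.le_of_dvd (Nat.pos_of_ne_zero hN𝔲) (map_dvd _ h)
      · -- a divisor of an ideal coprime to `𝔴` is coprime to `𝔴`
        rw [eq_top_iff, ← hcop]
        exact sup_le_sup_right (Ideal.le_of_dvd h) _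
  · simp only [if_neg hcop, mul_zero, zero_div, Finset.sum_const_zero]
    rw [sieveW, if_neg (fun h => hcop h.1), zero_div]

/-- **The main estimate with the coprime harmonic sum**: for `𝔴 ≠ 0`, `|c_P| ≤ C₀/NP` and `x ≥ 1`,
`|∑_{0<N𝔲≤x} W(𝔲)/N𝔲 − ρ_K d(𝔴) β'(x) log x| ≤ (E(𝔴) + 4ρ_K) ∑_{N𝔡≤x,(𝔡,𝔴)=1} |B(𝔡)| N𝔡^{-3/4}`,
where `β'(x) = ∑_{N𝔡 ≤ x, (𝔡,𝔴)=1} B(𝔡)/N𝔡`, `d(𝔴) = ∑_{𝔢∣𝔴} μ(𝔢)/N𝔢`,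
`E(𝔴) = ∑_{𝔢∣𝔴} (C + ρ_K log N𝔢)/N𝔢` with `C` the constant of `abs_coprimeHarmonic_sub_le`
(`W = B' ⋆ 𝟙_𝔴`, regroup `𝔲 = 𝔡𝔫'`, coprime harmonic sum at `x/N𝔡`, `log N𝔡/N𝔡 ≤ 4N𝔡^{-3/4}`,
`d(𝔴) ≤ 1`). [folklore] -/
theorem abs_sum_sieveW_div_sub_coprime_le :
    ∃ C : ℝ, 0 ≤ C ∧ ∀ (𝔴 : Ideal (𝓞 K)), 𝔴 ≠ ⊥ → ∀ (c : Ideal (𝓞 K) → ℝ) (x : ℝ), 1 ≤ x →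
      |∑ 𝔲 ∈ idealsLE K x, sieveW 𝔴 c 𝔲 / ((Ideal.absNorm 𝔲 : ℕ) : ℝ) -
          NumberField.dedekindZeta_residue K *
            (∑ 𝔢 ∈ idealDivisors K 𝔴, (idealMoebius 𝔢 : ℝ) / Ideal.absNorm 𝔢) *
            (∑ 𝔡 ∈ (idealsLE K x).filter (fun 𝔡 => 𝔡 ⊔ 𝔴 = ⊤),
              sieveB 𝔴 c 𝔡 / ((Ideal.absNorm 𝔡 : ℕ) : ℝ)) * Real.log x| ≤
        ((∑ 𝔢 ∈ idealDivisors K 𝔴,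
            (C + NumberField.dedekindZeta_residue K * Real.log (Ideal.absNorm 𝔢)) / Ideal.absNorm 𝔢) +
          4 * NumberField.dedekindZeta_residue K) *
          ∑ 𝔡 ∈ (idealsLE K x).filter (fun 𝔡 => 𝔡 ⊔ 𝔴 = ⊤),
            |sieveB 𝔴 c 𝔡| * ((Ideal.absNorm 𝔡 : ℕ) : ℝ) ^ (-(3 : ℝ) / 4) := by
  obtain ⟨C, hC⟩ := abs_coprimeHarmonic_sub_le (K := K)
  set ρ : ℝ := NumberField.dedekindZeta_residue K with hρ
  have hρ0 : 0 < ρ := NumberField.dedekindZeta_residue_pos K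
  -- `C ≥ 0`: the estimate at `𝔠 = (1)`, `y = 1`
  have hC0 : 0 ≤ C := by
    have h := hC ⊤ (by simp) 1 le_rfl
    have hdiv : idealDivisors K (⊤ : Ideal (𝓞 K)) = {⊤} := by
      ext 𝔢
      rw [mem_idealDivisors (by simp), Finset.mem_singleton, ← Ideal.one_eq_top, ← isUnit_iff_dvd_one,
        Ideal.isUnit_iff, Ideal.one_eq_top]
    rw [hdiv] at h
    simp only [Finset.sum_singleton, Ideal.absNorm_top, Nat.cast_one, Real.log_one, mul_zero, add_zero,
      div_one] at h
    exact (abs_nonneg _).trans h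
  refine ⟨C, hC0, fun 𝔴 h𝔴 c x hx => ?_⟩
  set A := idealsLE K x with hA
  set D := A.filter (fun 𝔡 => 𝔡 ⊔ 𝔴 = ⊤) with hDdef
  set d : ℝ := ∑ 𝔢 ∈ idealDivisors K 𝔴, (idealMoebius 𝔢 : ℝ) / Ideal.absNorm 𝔢 with hd
  set E : ℝ := ∑ 𝔢 ∈ idealDivisors K 𝔴, (C + ρ * Real.log (Ideal.absNorm 𝔢)) / Ideal.absNorm 𝔢 with hE
  -- `0 ≤ d ≤ 1`
  have hd01 : 0 ≤ d ∧ d ≤ 1 := by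
    rw [hd, dsum_eq_prod_one_sub_inv h𝔴]
    constructor
    · refine Finset.prod_nonneg fun P hP => ?_
      have h2 : (2 : ℝ) ≤ Ideal.absNorm P := by
        exact_mod_cast two_le_absNorm_of_prime (prime_of_normalized_factor P (Multiset.mem_toFinset.1 hP))
      have : 1 / (Ideal.absNorm P : ℝ) ≤ 1 / 2 := one_div_le_one_div_of_le (by norm_num) h2
      linarith
    · refine Finset.prod_le_one (fun P hP => ?_) (fun P hP => ?_)
      · have h2 : (2 : ℝ) ≤ Ideal.absNorm P := by
          exact_mod_cast two_le_absNorm_of_prime (prime_of_normalized_factor P (Multiset.mem_toFinset.1 hP))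
        have : 1 / (Ideal.absNorm P : ℝ) ≤ 1 / 2 := one_div_le_one_div_of_le (by norm_num) h2
        linarith
      · have : 0 ≤ 1 / (Ideal.absNorm P : ℝ) := by positivity
        linarith
  -- Step 1: `W = B' ⋆ 𝟙_𝔴`
  have hstep1 : ∑ 𝔲 ∈ A, sieveW 𝔴 c 𝔲 / ((Ideal.absNorm 𝔲 : ℕ) : ℝ) =
      ∑ 𝔲 ∈ A, ∑ 𝔡 ∈ D.filter (· ∣ 𝔲),
        sieveB 𝔴 c 𝔡 * (if 𝔲 ⊔ 𝔴 = ⊤ then 1 else 0) / ((Ideal.absNorm 𝔲 : ℕ) : ℝ) :=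
    Finset.sum_congr rfl fun 𝔲 h𝔲 => sieveW_div_eq_sum_coprime 𝔴 c h𝔲
  -- Step 2: regroup
  have hD0 : ∀ 𝔡 ∈ D, 𝔡 ≠ ⊥ := fun 𝔡 h => (mem_idealsLE.1 (Finset.mem_filter.1 h).1).1
  have hstep2 := sum_idealsLE_sum_filter_dvd_eq hD0
    (fun 𝔡 𝔲 => sieveB 𝔴 c 𝔡 * (if 𝔲 ⊔ 𝔴 = ⊤ then 1 else 0) / ((Ideal.absNorm 𝔲 : ℕ) : ℝ)) x
  rw [hstep1, hstep2]
  -- Step 3: inner sums are `B(𝔡)/N𝔡 · H_𝔴(x/N𝔡)` (for `𝔡` coprime to `𝔴`, `𝔡𝔫'` is coprime iff `𝔫'` is)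
  have hinner : ∀ 𝔡 ∈ D, ∑ 𝔫' ∈ idealsLE K (x / Ideal.absNorm 𝔡),
      sieveB 𝔴 c 𝔡 * (if 𝔡 * 𝔫' ⊔ 𝔴 = ⊤ then 1 else 0) / ((Ideal.absNorm (𝔡 * 𝔫') : ℕ) : ℝ) =
      sieveB 𝔴 c 𝔡 / ((Ideal.absNorm 𝔡 : ℕ) : ℝ) *
        ∑ 𝔫' ∈ (idealsLE K (x / Ideal.absNorm 𝔡)).filter (fun 𝔫 => 𝔫 ⊔ 𝔴 = ⊤),
          ((Ideal.absNorm 𝔫' : ℕ) : ℝ)⁻¹ := by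
    intro 𝔡 h𝔡
    have hdcop : 𝔡 ⊔ 𝔴 = ⊤ := (Finset.mem_filter.1 h𝔡).2
    rw [Finset.mul_sum, Finset.sum_filter]
    refine Finset.sum_congr rfl fun 𝔫' _ => ?_
    have hiff : 𝔡 * 𝔫' ⊔ 𝔴 = ⊤ ↔ 𝔫' ⊔ 𝔴 = ⊤ := by
      rw [mul_sup_eq_top_iff]
      exact ⟨fun h => h.2, fun h => ⟨hdcop, h⟩⟩
    by_cases h𝔫 : 𝔫' ⊔ 𝔴 = ⊤
    · rw [if_pos (hiff.2 h𝔫), if_pos h𝔫, map_mul, Nat.cast_mul, mul_one, div_mul_eq_div_div,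
        div_eq_mul_inv]
    · rw [if_neg (fun h => h𝔫 (hiff.1 h)), if_neg h𝔫]
      simp
  rw [Finset.sum_congr rfl hinner, Finset.mul_sum, Finset.sum_mul, ← Finset.sum_sub_distrib]
  -- Step 4: termwise
  have hterm : ∀ 𝔡 ∈ D,
      |sieveB 𝔴 c 𝔡 / ((Ideal.absNorm 𝔡 : ℕ) : ℝ) *
          ∑ 𝔫' ∈ (idealsLE K (x / Ideal.absNorm 𝔡)).filter (fun 𝔫 => 𝔫 ⊔ 𝔴 = ⊤),
            ((Ideal.absNorm 𝔫' : ℕ) : ℝ)⁻¹ -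
        ρ * d * (sieveB 𝔴 c 𝔡 / ((Ideal.absNorm 𝔡 : ℕ) : ℝ)) * Real.log x| ≤
      (E + 4 * ρ) * (|sieveB 𝔴 c 𝔡| * ((Ideal.absNorm 𝔡 : ℕ) : ℝ) ^ (-(3 : ℝ) / 4)) := by
    intro 𝔡 h𝔡
    have h𝔡A : 𝔡 ∈ A := (Finset.mem_filter.1 h𝔡).1
    set N : ℝ := ((Ideal.absNorm 𝔡 : ℕ) : ℝ) with hN
    have hN1 : 1 ≤ N := one_le_absNorm_of_mem_idealsLE h𝔡A
    have hN0 : 0 < N := by linarith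
    have hNx : N ≤ x := (mem_idealsLE.1 h𝔡A).2
    have hz : 1 ≤ x / N := by rwa [le_div_iff₀ hN0, one_mul]
    set H : ℝ := ∑ 𝔫' ∈ (idealsLE K (x / N)).filter (fun 𝔫 => 𝔫 ⊔ 𝔴 = ⊤),
      ((Ideal.absNorm 𝔫' : ℕ) : ℝ)⁻¹ with hH
    have hHb := hC 𝔴 h𝔴 (x / N) hz
    rw [Real.log_div (by linarith) hN0.ne'] at hHb
    have hkey : |H - ρ * d * Real.log x| ≤ E + ρ * d * Real.log N := by
      have : H - ρ * d * Real.log x = (H - ρ * d * (Real.log x - Real.log N)) - ρ * d * Real.log N := by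
        ring
      rw [this]
      refine (abs_sub _ _).trans (add_le_add hHb ?_)
      rw [abs_of_nonneg (mul_nonneg (mul_nonneg hρ0.le hd01.1) (Real.log_nonneg hN1))]
    have hN1' : 1 ≤ Ideal.absNorm 𝔡 :=
      Nat.one_le_iff_ne_zero.2 (by rw [Ne, Ideal.absNorm_eq_zero_iff]; exact (mem_idealsLE.1 h𝔡A).1)
    have hlog : Real.log N / N ≤ 4 * N ^ (-(3 : ℝ) / 4) :=
      Literature.NumberTheory.Sieve.SquarefreeSums.log_div_le_rpow_neg hN1'
    have hinv : 1 / N ≤ N ^ (-(3 : ℝ) / 4) :=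
      Literature.NumberTheory.Sieve.SquarefreeSums.inv_le_rpow_neg hN1'
    have hE0 : 0 ≤ E := by
      rw [hE]
      refine Finset.sum_nonneg fun 𝔢 h𝔢 => div_nonneg (add_nonneg hC0 (mul_nonneg hρ0.le
        (Real.log_nonneg ?_))) (Nat.cast_nonneg _)
      exact_mod_cast Nat.one_le_iff_ne_zero.2 (by
        rw [Ne, Ideal.absNorm_eq_zero_iff]; exact ne_bot_of_mem_idealDivisors h𝔴 h𝔢)
    calc |sieveB 𝔴 c 𝔡 / N * H - ρ * d * (sieveB 𝔴 c 𝔡 / N) * Real.log x|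
        = |sieveB 𝔴 c 𝔡| / N * |H - ρ * d * Real.log x| := by
          rw [show sieveB 𝔴 c 𝔡 / N * H - ρ * d * (sieveB 𝔴 c 𝔡 / N) * Real.log x =
              sieveB 𝔴 c 𝔡 / N * (H - ρ * d * Real.log x) by ring, abs_mul, abs_div, abs_of_pos hN0]
      _ ≤ |sieveB 𝔴 c 𝔡| / N * (E + ρ * d * Real.log N) :=
          mul_le_mul_of_nonneg_left hkey (by positivity)
      _ = |sieveB 𝔴 c 𝔡| * (E * (1 / N) + ρ * d * (Real.log N / N)) := by ring
      _ ≤ |sieveB 𝔴 c 𝔡| * (E * N ^ (-(3 : ℝ) / 4) + ρ * 1 * (4 * N ^ (-(3 : ℝ) / 4))) := by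
          refine mul_le_mul_of_nonneg_left (add_le_add ?_ ?_) (abs_nonneg _)
          · exact mul_le_mul_of_nonneg_left hinv hE0
          · have hlog0 : 0 ≤ Real.log N / N := div_nonneg (Real.log_nonneg hN1) hN0.le
            calc ρ * d * (Real.log N / N) ≤ ρ * 1 * (Real.log N / N) :=
                  mul_le_mul_of_nonneg_right (mul_le_mul_of_nonneg_left hd01.2 hρ0.le) hlog0
              _ ≤ ρ * 1 * (4 * N ^ (-(3 : ℝ) / 4)) := mul_le_mul_of_nonneg_left hlog (by positivity)
      _ = (E + 4 * ρ) * (|sieveB 𝔴 c 𝔡| * N ^ (-(3 : ℝ) / 4)) := by ring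
  refine (Finset.abs_sum_le_sum_abs _ _).trans ((Finset.sum_le_sum hterm).trans ?_)
  rw [← Finset.mul_sum]

/-! ### `β'(x) = 1 + O(D₀^{-1/4})` -/

/-- **`|β'(x) − 1| ≤ D₀^{-1/4} ∑_{(𝔡,𝔴)=1} |B(𝔡)| N𝔡^{-3/4}`** for `x ≥ 1`, when every prime of norm
`≤ D₀` (`D₀ ≥ 1`) divides `𝔴`: the term `𝔡 = (1)` is `1`, and every other `𝔡` coprime to `𝔴` has a
prime factor of norm `> D₀`, so `N𝔡 > D₀` and `1/N𝔡 ≤ D₀^{-1/4} N𝔡^{-3/4}`.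
(The analogue of `SquarefreeSums.abs_bsum_sub_one_le`.) [folklore] -/
theorem abs_bsum_coprime_sub_one_le {D₀ : ℝ} (hD₀ : 1 ≤ D₀)
    (hD : ∀ P : Ideal (𝓞 K), Prime P → (Ideal.absNorm P : ℝ) ≤ D₀ → P ∣ 𝔴) {x : ℝ} (hx : 1 ≤ x) :
    |∑ 𝔡 ∈ (idealsLE K x).filter (fun 𝔡 => 𝔡 ⊔ 𝔴 = ⊤), sieveB 𝔴 c 𝔡 / ((Ideal.absNorm 𝔡 : ℕ) : ℝ) - 1| ≤
      D₀ ^ (-(1 : ℝ) / 4) * ∑ 𝔡 ∈ (idealsLE K x).filter (fun 𝔡 => 𝔡 ⊔ 𝔴 = ⊤),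
        |sieveB 𝔴 c 𝔡| * ((Ideal.absNorm 𝔡 : ℕ) : ℝ) ^ (-(3 : ℝ) / 4) := by
  set D := (idealsLE K x).filter (fun 𝔡 => 𝔡 ⊔ 𝔴 = ⊤) with hDdef
  have htop : (⊤ : Ideal (𝓞 K)) ∈ D := by
    rw [hDdef, Finset.mem_filter, mem_idealsLE]
    exact ⟨⟨by simp, by rw [Ideal.absNorm_top, Nat.cast_one]; exact hx⟩, by simp⟩
  have hBtop : sieveB 𝔴 c ⊤ / ((Ideal.absNorm (⊤ : Ideal (𝓞 K)) : ℕ) : ℝ) = 1 := by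
    rw [sieveB, ppMul_top, Ideal.absNorm_top, Nat.cast_one, div_one]
  rw [← Finset.add_sum_erase D _ htop, hBtop, add_sub_cancel_left]
  -- each remaining term
  have hterm : ∀ 𝔡 ∈ D.erase ⊤, |sieveB 𝔴 c 𝔡 / ((Ideal.absNorm 𝔡 : ℕ) : ℝ)| ≤
      D₀ ^ (-(1 : ℝ) / 4) * (|sieveB 𝔴 c 𝔡| * ((Ideal.absNorm 𝔡 : ℕ) : ℝ) ^ (-(3 : ℝ) / 4)) := by
    intro 𝔡 h𝔡
    obtain ⟨hne, h𝔡D⟩ := Finset.mem_erase.1 h𝔡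
    obtain ⟨h𝔡A, hcop⟩ := Finset.mem_filter.1 h𝔡D
    have h𝔡0 := (mem_idealsLE.1 h𝔡A).1
    have h𝔡0' : (𝔡 : Ideal (𝓞 K)) ≠ 0 := by rwa [Ne, Ideal.zero_eq_bot]
    -- a prime factor of norm `> D₀`
    have hnf : normalizedFactors 𝔡 ≠ 0 := by
      intro h0
      rw [normalizedFactors_eq_zero_iff h𝔡0', Ideal.isUnit_iff] at h0
      exact hne h0
    obtain ⟨Q, hQ⟩ := Multiset.exists_mem_of_ne_zero hnf
    have hQp := prime_of_normalized_factor Q hQ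
    have hQw : ¬ Q ∣ 𝔴 := (sup_eq_top_iff_forall_not_dvd h𝔡0).1 hcop Q hQ
    have hQD : D₀ < Ideal.absNorm Q := by
      by_contra hle
      exact hQw (hD Q hQp (not_lt.1 hle))
    set N : ℝ := ((Ideal.absNorm 𝔡 : ℕ) : ℝ) with hN
    have hN𝔡 : Ideal.absNorm 𝔡 ≠ 0 := by rwa [Ne, Ideal.absNorm_eq_zero_iff]
    have hND : D₀ < N := by
      have hdvd : Ideal.absNorm Q ∣ Ideal.absNorm 𝔡 := map_dvd _ (dvd_of_mem_normalizedFactors hQ)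
      have hle : (Ideal.absNorm Q : ℝ) ≤ N := by
        rw [hN]; exact_mod_cast Nat.le_of_dvd (Nat.pos_of_ne_zero hN𝔡) hdvd
      exact hQD.trans_le hle
    have hN0 : 0 < N := by linarith
    have hsplit : (1 : ℝ) / N = N ^ (-(1 : ℝ) / 4) * N ^ (-(3 : ℝ) / 4) := by
      rw [← Real.rpow_add hN0, one_div, ← Real.rpow_neg_one]
      norm_num
    have hmono : N ^ (-(1 : ℝ) / 4) ≤ D₀ ^ (-(1 : ℝ) / 4) :=
      Real.rpow_le_rpow_of_nonpos (by linarith) hND.le (by norm_num)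
    rw [abs_div, abs_of_pos hN0, div_eq_mul_one_div, hsplit]
    calc |sieveB 𝔴 c 𝔡| * (N ^ (-(1 : ℝ) / 4) * N ^ (-(3 : ℝ) / 4))
        ≤ |sieveB 𝔴 c 𝔡| * (D₀ ^ (-(1 : ℝ) / 4) * N ^ (-(3 : ℝ) / 4)) :=
          mul_le_mul_of_nonneg_left (mul_le_mul_of_nonneg_right hmono (by positivity)) (abs_nonneg _)
      _ = D₀ ^ (-(1 : ℝ) / 4) * (|sieveB 𝔴 c 𝔡| * N ^ (-(3 : ℝ) / 4)) := by ring
  refine (Finset.abs_sum_le_sum_abs _ _).trans ((Finset.sum_le_sum hterm).trans ?_)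
  rw [← Finset.mul_sum]
  refine mul_le_mul_of_nonneg_left ?_ (by positivity)
  exact Finset.sum_le_sum_of_subset_of_nonneg (Finset.erase_subset _ _) fun _ _ _ => by positivity

/-! ### The assembled sharp estimate and its specialisations -/

/-- **One-dimensional sieve sums over `𝓞_K`, sharp form**: there are `C, Z ≥ 0` (depending on `K`
only) such that for every nonzero `𝔴`, all weights `|c_P| ≤ C₀/NP` (`C₀ ≥ 0`), every `D₀ ≥ 1` such
that each prime of norm `≤ D₀` divides `𝔴`, and every `x ≥ 1`,
`|∑_{0<N𝔲≤x} W(𝔲)/N𝔲 − ρ_K (φ(𝔴)/N𝔴) log x| ≤ e^{(1+2C₀)Z} (E_C(𝔴) + 4ρ_K + ρ_K D₀^{-1/4} log x)`,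
`W(𝔲) = 1_{(𝔲,𝔴)=1} μ²(𝔲) ∏_{P∣𝔲}(1 + c_P)`, `φ(𝔴)/N𝔴 = ∑_{𝔢∣𝔴} μ(𝔢)/N𝔢` (`dsum_eq_prod_one_sub_inv`),
`E_C(𝔴) = ∑_{𝔢∣𝔴} (C + ρ_K log N𝔢)/N𝔢`. The relative error `ρ_K D₀^{-1/4}` is uniform in `𝔴`
(the analogue of `SquarefreeSums.abs_sum_wfun_div_sub_le` + `abs_bsum_sub_one_le` over `ℤ`).
[cite: CastilloEtAl2015, §2.2 (∑_{(𝔲,𝔴)=1} μ²(𝔲)/φ(𝔲) ≪ φ(𝔴) log R/|𝔴|)] -/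
theorem abs_sum_sieveW_div_sub_sharp :
    ∃ C Z : ℝ, 0 ≤ C ∧ 0 ≤ Z ∧ ∀ (𝔴 : Ideal (𝓞 K)), 𝔴 ≠ ⊥ → ∀ (c : Ideal (𝓞 K) → ℝ) (C₀ : ℝ),
      0 ≤ C₀ → (∀ P : Ideal (𝓞 K), Prime P → |c P| ≤ C₀ / Ideal.absNorm P) → ∀ D₀ : ℝ, 1 ≤ D₀ →
      (∀ P : Ideal (𝓞 K), Prime P → (Ideal.absNorm P : ℝ) ≤ D₀ → P ∣ 𝔴) → ∀ x : ℝ, 1 ≤ x →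
      |∑ 𝔲 ∈ idealsLE K x, sieveW 𝔴 c 𝔲 / ((Ideal.absNorm 𝔲 : ℕ) : ℝ) -
          NumberField.dedekindZeta_residue K *
            (∑ 𝔢 ∈ idealDivisors K 𝔴, (idealMoebius 𝔢 : ℝ) / Ideal.absNorm 𝔢) * Real.log x| ≤
        Real.exp ((1 + 2 * C₀) * Z) *
          ((∑ 𝔢 ∈ idealDivisors K 𝔴,
              (C + NumberField.dedekindZeta_residue K * Real.log (Ideal.absNorm 𝔢)) / Ideal.absNorm 𝔢) +
            4 * NumberField.dedekindZeta_residue K +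
            NumberField.dedekindZeta_residue K * D₀ ^ (-(1 : ℝ) / 4) * Real.log x) := by
  obtain ⟨C, hC0, hmain⟩ := abs_sum_sieveW_div_sub_coprime_le (K := K)
  set ρ : ℝ := NumberField.dedekindZeta_residue K with hρ
  have hρ0 : 0 < ρ := NumberField.dedekindZeta_residue_pos K
  set Z : ℝ := ∑' v : IsDedekindDomain.HeightOneSpectrum (𝓞 K),
    ((Ideal.absNorm v.asIdeal : ℕ) : ℝ) ^ (-(3 : ℝ) / 2) with hZ
  have hZsum : Summable fun v : IsDedekindDomain.HeightOneSpectrum (𝓞 K) =>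
      ((Ideal.absNorm v.asIdeal : ℕ) : ℝ) ^ (-(3 : ℝ) / 2) := by
    have := summable_absNorm_rpow_neg (K := K) (s := 3 / 2) (by norm_num)
    refine this.congr fun v => ?_
    norm_num
  have hZ0 : 0 ≤ Z := tsum_nonneg fun v => by positivity
  refine ⟨C, Z, hC0, hZ0, fun 𝔴 h𝔴 c C₀ hC₀ hc D₀ hD₀ hD x hx => ?_⟩
  have h1 := hmain 𝔴 h𝔴 c x hx
  have h2 := abs_bsum_coprime_sub_one_le 𝔴 c hD₀ hD hx
  have hmaj := sum_abs_sieveB_mul_rpow_coprime_le 𝔴 c hC₀ hc x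
  have hT : ∑ P ∈ (finite_primeIdealsLE K x).toFinset, ((Ideal.absNorm P : ℕ) : ℝ) ^ (-(3 : ℝ) / 2) ≤ Z :=
    sum_primeIdealsLE_le_tsum (g := fun P => ((Ideal.absNorm P : ℕ) : ℝ) ^ (-(3 : ℝ) / 2))
      (fun P => by positivity) hZsum x
  set M : ℝ := ∑ 𝔡 ∈ (idealsLE K x).filter (fun 𝔡 => 𝔡 ⊔ 𝔴 = ⊤),
    |sieveB 𝔴 c 𝔡| * ((Ideal.absNorm 𝔡 : ℕ) : ℝ) ^ (-(3 : ℝ) / 4) with hM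
  have hM0 : 0 ≤ M := Finset.sum_nonneg fun _ _ => by positivity
  have h12 : 0 ≤ 1 + 2 * C₀ := by linarith
  set E2 : ℝ := Real.exp ((1 + 2 * C₀) * Z) with hE2
  have hMle : M ≤ E2 := hmaj.trans (Real.exp_le_exp.2 (mul_le_mul_of_nonneg_left hT h12))
  set S := ∑ 𝔲 ∈ idealsLE K x, sieveW 𝔴 c 𝔲 / ((Ideal.absNorm 𝔲 : ℕ) : ℝ) with hSdef
  set β := ∑ 𝔡 ∈ (idealsLE K x).filter (fun 𝔡 => 𝔡 ⊔ 𝔴 = ⊤),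
    sieveB 𝔴 c 𝔡 / ((Ideal.absNorm 𝔡 : ℕ) : ℝ) with hβ
  set d := ∑ 𝔢 ∈ idealDivisors K 𝔴, (idealMoebius 𝔢 : ℝ) / Ideal.absNorm 𝔢 with hd
  set E : ℝ := ∑ 𝔢 ∈ idealDivisors K 𝔴, (C + ρ * Real.log (Ideal.absNorm 𝔢)) / Ideal.absNorm 𝔢 with hE
  have hd01 : 0 ≤ d ∧ d ≤ 1 := by
    rw [hd, dsum_eq_prod_one_sub_inv h𝔴]
    constructor
    · refine Finset.prod_nonneg fun P hP => ?_
      have h2 : (2 : ℝ) ≤ Ideal.absNorm P := by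
        exact_mod_cast two_le_absNorm_of_prime (prime_of_normalized_factor P (Multiset.mem_toFinset.1 hP))
      have : 1 / (Ideal.absNorm P : ℝ) ≤ 1 / 2 := one_div_le_one_div_of_le (by norm_num) h2
      linarith
    · refine Finset.prod_le_one (fun P hP => ?_) (fun P hP => ?_)
      · have h2 : (2 : ℝ) ≤ Ideal.absNorm P := by
          exact_mod_cast two_le_absNorm_of_prime (prime_of_normalized_factor P (Multiset.mem_toFinset.1 hP))
        have : 1 / (Ideal.absNorm P : ℝ) ≤ 1 / 2 := one_div_le_one_div_of_le (by norm_num) h2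
        linarith
      · have : 0 ≤ 1 / (Ideal.absNorm P : ℝ) := by positivity
        linarith
  have hE0 : 0 ≤ E := by
    rw [hE]
    refine Finset.sum_nonneg fun 𝔢 h𝔢 => div_nonneg (add_nonneg hC0 (mul_nonneg hρ0.le
      (Real.log_nonneg ?_))) (Nat.cast_nonneg _)
    exact_mod_cast Nat.one_le_iff_ne_zero.2 (by
      rw [Ne, Ideal.absNorm_eq_zero_iff]; exact ne_bot_of_mem_idealDivisors h𝔴 h𝔢)
  have hlog0 : 0 ≤ Real.log x := Real.log_nonneg hx
  have hD4 : 0 ≤ D₀ ^ (-(1 : ℝ) / 4) := by positivity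
  -- `|S − ρ d log x| ≤ |S − ρ d β log x| + ρ d log x |β − 1|`
  have hsplit : S - ρ * d * Real.log x = (S - ρ * d * β * Real.log x) + ρ * d * Real.log x * (β - 1) := by
    ring
  rw [hsplit]
  refine (abs_add_le _ _).trans ?_
  have hA : |S - ρ * d * β * Real.log x| ≤ (E + 4 * ρ) * E2 :=
    h1.trans (mul_le_mul_of_nonneg_left hMle (by positivity))
  have hB : |ρ * d * Real.log x * (β - 1)| ≤ ρ * Real.log x * (D₀ ^ (-(1 : ℝ) / 4) * E2) := by
    rw [abs_mul, abs_of_nonneg (mul_nonneg (mul_nonneg hρ0.le hd01.1) hlog0)]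
    calc ρ * d * Real.log x * |β - 1| ≤ ρ * 1 * Real.log x * |β - 1| := by
          refine mul_le_mul_of_nonneg_right ?_ (abs_nonneg _)
          exact mul_le_mul_of_nonneg_right (mul_le_mul_of_nonneg_left hd01.2 hρ0.le) hlog0
      _ = ρ * Real.log x * |β - 1| := by ring
      _ ≤ ρ * Real.log x * (D₀ ^ (-(1 : ℝ) / 4) * E2) := by
          refine mul_le_mul_of_nonneg_left (h2.trans ?_) (mul_nonneg hρ0.le hlog0)
          exact mul_le_mul_of_nonneg_left hMle hD4
  refine (add_le_add hA hB).trans (le_of_eq ?_)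
  ring

/-- **`∑_{N𝔲 ≤ x, (𝔲,𝔴)=1} μ²(𝔲)/φ(𝔲) = ρ_K (φ(𝔴)/N𝔴) log x (1 + O(D₀^{-1/4})) + O(E(𝔴))`** — the sharp
number-field analogue of Maynard's (5.13)/(6.5) (`SquarefreeSums.abs_sum_inv_totient_sub_le` over `ℤ`):
there are `C, Z ≥ 0` with
`|∑ 1/φ(𝔲) − ρ_K (φ(𝔴)/N𝔴) log x| ≤ e^{5Z} (E_C(𝔴) + 4ρ_K + ρ_K D₀^{-1/4} log x)` for all `𝔴 ≠ 0`,
`D₀ ≥ 1` as above and `x ≥ 1` (`φ(𝔲) = ∏_{P∣𝔲}(NP−1)`).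
[cite: CastilloEtAl2015, §2.2 (∑_{N𝔲<R,(𝔲,𝔴)=1} μ²(𝔲)/φ(𝔲) ≪ φ(𝔴) log R/|𝔴|)] -/
theorem abs_sum_inv_totientIdeal_sub_sharp :
    ∃ C Z : ℝ, 0 ≤ C ∧ 0 ≤ Z ∧ ∀ (𝔴 : Ideal (𝓞 K)), 𝔴 ≠ ⊥ → ∀ D₀ : ℝ, 1 ≤ D₀ →
      (∀ P : Ideal (𝓞 K), Prime P → (Ideal.absNorm P : ℝ) ≤ D₀ → P ∣ 𝔴) → ∀ x : ℝ, 1 ≤ x →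
      |∑ 𝔲 ∈ (idealsLE K x).filter (fun 𝔲 => 𝔲 ⊔ 𝔴 = ⊤ ∧ Squarefree 𝔲),
          ∏ P ∈ (normalizedFactors 𝔲).toFinset, 1 / ((Ideal.absNorm P : ℝ) - 1) -
          NumberField.dedekindZeta_residue K *
            (∑ 𝔢 ∈ idealDivisors K 𝔴, (idealMoebius 𝔢 : ℝ) / Ideal.absNorm 𝔢) * Real.log x| ≤
        Real.exp (5 * Z) *
          ((∑ 𝔢 ∈ idealDivisors K 𝔴,
              (C + NumberField.dedekindZeta_residue K * Real.log (Ideal.absNorm 𝔢)) / Ideal.absNorm 𝔢) +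
            4 * NumberField.dedekindZeta_residue K +
            NumberField.dedekindZeta_residue K * D₀ ^ (-(1 : ℝ) / 4) * Real.log x) := by
  obtain ⟨C, Z, hC0, hZ0, h⟩ := abs_sum_sieveW_div_sub_sharp (K := K)
  refine ⟨C, Z, hC0, hZ0, fun 𝔴 h𝔴 D₀ hD₀ hD x hx => ?_⟩
  set cT : Ideal (𝓞 K) → ℝ := fun P => 1 / ((Ideal.absNorm P : ℝ) - 1) with hcT
  have hc2 : ∀ P : Ideal (𝓞 K), Prime P → |cT P| ≤ 2 / Ideal.absNorm P := by
    intro P hP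
    have hN2 : (2 : ℝ) ≤ Ideal.absNorm P := by exact_mod_cast two_le_absNorm_of_prime hP
    rw [hcT]
    dsimp only
    rw [abs_of_pos (by apply div_pos one_pos; linarith), div_le_div_iff₀ (by linarith) (by linarith)]
    linarith
  have hS : ∑ 𝔲 ∈ (idealsLE K x).filter (fun 𝔲 => 𝔲 ⊔ 𝔴 = ⊤ ∧ Squarefree 𝔲),
      ∏ P ∈ (normalizedFactors 𝔲).toFinset, 1 / ((Ideal.absNorm P : ℝ) - 1) =
      ∑ 𝔲 ∈ idealsLE K x, sieveW 𝔴 cT 𝔲 / ((Ideal.absNorm 𝔲 : ℕ) : ℝ) := by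
    rw [Finset.sum_filter]
    refine Finset.sum_congr rfl fun 𝔲 h𝔲 => ?_
    rw [sieveW_totient_div_absNorm 𝔴 (mem_idealsLE.1 h𝔲).1]
  rw [hS]
  have h' := h 𝔴 h𝔴 cT 2 zero_le_two hc2 D₀ hD₀ hD x hx
  have h5 : (1 + 2 * (2 : ℝ)) * Z = 5 * Z := by ring
  rwa [h5] at h'

/-- **`∑_{N𝔲 ≤ x, (𝔲,𝔴)=1} μ²(𝔲)/g(𝔲) = ρ_K (φ(𝔴)/N𝔴) log x (1 + O(D₀^{-1/4})) + O(E(𝔴))`** with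
`g(𝔲) = ∏_{P∣𝔲}(NP − 2)` — the sharp analogue of Maynard's (5.20)/(6.11)
(`SquarefreeSums.abs_sum_inv_g_sub_le` over `ℤ`): for `D₀ ≥ 2` such that each prime of norm `≤ D₀`
divides `𝔴` (so `NP ≥ 3` off `𝔴`) and `x ≥ 1`,
`|∑ 1/g(𝔲) − ρ_K (φ(𝔴)/N𝔴) log x| ≤ e^{13Z} (E_C(𝔴) + 4ρ_K + ρ_K D₀^{-1/4} log x)`.
[cite: CastilloEtAl2015, §2.2] -/
theorem abs_sum_inv_gIdeal_sub_sharp :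
    ∃ C Z : ℝ, 0 ≤ C ∧ 0 ≤ Z ∧ ∀ (𝔴 : Ideal (𝓞 K)), 𝔴 ≠ ⊥ → ∀ D₀ : ℝ, 2 ≤ D₀ →
      (∀ P : Ideal (𝓞 K), Prime P → (Ideal.absNorm P : ℝ) ≤ D₀ → P ∣ 𝔴) → ∀ x : ℝ, 1 ≤ x →
      |∑ 𝔲 ∈ (idealsLE K x).filter (fun 𝔲 => 𝔲 ⊔ 𝔴 = ⊤ ∧ Squarefree 𝔲),
          ∏ P ∈ (normalizedFactors 𝔲).toFinset, 1 / ((Ideal.absNorm P : ℝ) - 2) -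
          NumberField.dedekindZeta_residue K *
            (∑ 𝔢 ∈ idealDivisors K 𝔴, (idealMoebius 𝔢 : ℝ) / Ideal.absNorm 𝔢) * Real.log x| ≤
        Real.exp (13 * Z) *
          ((∑ 𝔢 ∈ idealDivisors K 𝔴,
              (C + NumberField.dedekindZeta_residue K * Real.log (Ideal.absNorm 𝔢)) / Ideal.absNorm 𝔢) +
            4 * NumberField.dedekindZeta_residue K +
            NumberField.dedekindZeta_residue K * D₀ ^ (-(1 : ℝ) / 4) * Real.log x) := by
  obtain ⟨C, Z, hC0, hZ0, h⟩ := abs_sum_sieveW_div_sub_sharp (K := K)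
  refine ⟨C, Z, hC0, hZ0, fun 𝔴 h𝔴 D₀ hD₀ hD x hx => ?_⟩
  set cG : Ideal (𝓞 K) → ℝ := fun P => 2 / ((Ideal.absNorm P : ℝ) - 2) with hcG
  have h3 : ∀ P : Ideal (𝓞 K), Prime P → ¬ P ∣ 𝔴 → (3 : ℝ) ≤ Ideal.absNorm P := by
    intro P hP hPw
    have hgt : D₀ < Ideal.absNorm P := by
      by_contra hle; exact hPw (hD P hP (not_lt.1 hle))
    have h2 : (2 : ℕ) < Ideal.absNorm P := by exact_mod_cast hD₀.trans_lt hgt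
    exact_mod_cast h2
  have hcG_le : ∀ P : Ideal (𝓞 K), Prime P → |cG P| ≤ 6 / Ideal.absNorm P := by
    intro P hP
    have hN2 : (2 : ℝ) ≤ Ideal.absNorm P := by exact_mod_cast two_le_absNorm_of_prime hP
    rw [hcG]
    dsimp only
    by_cases hPw : P ∣ 𝔴
    · rcases hN2.eq_or_lt with h2 | h2
      · rw [← h2]; norm_num
      · have hN3 : (3 : ℝ) ≤ Ideal.absNorm P := by
          have : (2 : ℕ) < Ideal.absNorm P := by exact_mod_cast h2
          exact_mod_cast this
        rw [abs_of_pos (by apply div_pos two_pos; linarith),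
          div_le_div_iff₀ (by linarith) (by linarith)]
        linarith
    · have hN3 := h3 P hP hPw
      rw [abs_of_pos (by apply div_pos two_pos; linarith),
        div_le_div_iff₀ (by linarith) (by linarith)]
      linarith
  have hS : ∑ 𝔲 ∈ (idealsLE K x).filter (fun 𝔲 => 𝔲 ⊔ 𝔴 = ⊤ ∧ Squarefree 𝔲),
      ∏ P ∈ (normalizedFactors 𝔲).toFinset, 1 / ((Ideal.absNorm P : ℝ) - 2) =
      ∑ 𝔲 ∈ idealsLE K x, sieveW 𝔴 cG 𝔲 / ((Ideal.absNorm 𝔲 : ℕ) : ℝ) := by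
    rw [Finset.sum_filter]
    refine Finset.sum_congr rfl fun 𝔲 h𝔲 => ?_
    rw [sieveW_g_div_absNorm 𝔴 (mem_idealsLE.1 h𝔲).1 fun P hP hPw =>
      h3 P (prime_of_normalized_factor P hP) hPw]
  rw [hS]
  have h' := h 𝔴 h𝔴 cG 6 (by norm_num) hcG_le D₀ (by linarith) hD x hx
  have h13 : (1 + 2 * (6 : ℝ)) * Z = 13 * Z := by ring
  rwa [h13] at h'

end Literature.NumberTheory.Sieve.IdealSieve
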